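import Literature.NumberTheory.Sieve.RoughNumbersInProgressions
import HarnessLib

/-!
# Brun–Titchmarsh for short intervals: `π(N + M) − π(N) ≪ M / log M`

Topic `Literature/NumberTheory/Sieve`.  Everything here is PROVED from the tree's upper-bound
beta-sieve (`SieveSequence.sifted_le_of_dvd_primesProdBelow`, `SieveFrameworkUpperBound.lean`),
exactly as `RoughNumbersInProgressions.lean` does for the initial segment of a progression; the
present file treats a SHIFTED interval `(N, N + M]` (modulus `1`), which is the form consumed by
mean value theorems for Dirichlet polynomials supported on the primes (Gallagher; Granville–Harper–
Soundararajan, *A more intuitive proof of … Halász's theorem*, Lemma 1: "using the Brun–Titchmarsh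
theorem, the sum over `n` [`|n - m| ≪ m/T`] is seen to be `≪ m`").

* `card_Ioc_filter_dvd_eq`, `abs_card_Ioc_filter_dvd_sub_le` — the multiples of `d` in `(N, N+M]`
  number `⌊(N+M)/d⌋ − ⌊N/d⌋ = M/d + O(2)`;
* `card_rough_Ioc_le` — `#{N < n ≤ N + M : (n, P(z)) = 1} ≤ K (M / log z + z^{10})` for an absolute
  `K`, all real `z ≥ 2` and all `N, M` (beta-sieve of level `D = z^{10}`, dimension `1`, for the
  sequence `a_n = 1_{n > N}`, `X = x − N`, `g(d) = 1/d`, `|R_d| ≤ 2`, `V(z) ≤ 1/log z`);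
* `card_primes_Ioc_le` — **Brun–Titchmarsh, weak form**: `#{N < p ≤ N + M} ≤ C M / log M` for an
  absolute `C`, all `N` and all `M ≥ 2` (`z = M^{1/20}`; the classical constant `2` of
  Montgomery–Vaughan is not asserted);
* `sum_log_primes_Ioc_le` — the same for `∑_{N < p ≤ N+M} log p ≤ C M log(N+M)/log M`.

## References
* H. Halberstam, H.-E. Richert, *Sieve Methods*, Academic Press 1974, Ch. 3 (the Brun–Titchmarsh
  theorem via Selberg's sieve; not held — only the classical shape `≪ M/log M` is asserted, as
  [folklore]). [cite: HalberstamRichert1974, Ch. 3 (Brun–Titchmarsh theorem)]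
* H. L. Montgomery, R. C. Vaughan, *The large sieve*, Mathematika 20 (1973) (the constant `2`).
-/

noncomputable section

open Finset

namespace Literature.NumberTheory.Sieve

/-! ### Multiples of `d` in `(N, M]` -/

/-- The multiples of `d ≥ 1` in `(N, M]` are the `d k`, `N/d < k ≤ M/d`:
`#{N < n ≤ M : d ∣ n} = ⌊M/d⌋ − ⌊N/d⌋`. [folklore] -/
theorem card_Ioc_filter_dvd_eq {d : ℕ} (hd : 0 < d) (N M : ℕ) :
    #((Ioc N M).filter (fun n : ℕ => d ∣ n)) = M / d - N / d := by
  have himage : (Ioc N M).filter (fun n : ℕ => d ∣ n) = (Ioc (N / d) (M / d)).image (fun k => d * k) := by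
    ext n
    simp only [mem_filter, mem_Ioc, mem_image]
    constructor
    · rintro ⟨⟨hNn, hnM⟩, ⟨k, rfl⟩⟩
      refine ⟨k, ⟨?_, ?_⟩, rfl⟩
      · exact (Nat.div_lt_iff_lt_mul hd).2 (by rw [mul_comm]; exact hNn)
      · exact (Nat.le_div_iff_mul_le hd).2 (by rw [mul_comm]; exact hnM)
    · rintro ⟨k, ⟨hNk, hkM⟩, rfl⟩
      refine ⟨⟨?_, ?_⟩, dvd_mul_right d k⟩
      · have := (Nat.div_lt_iff_lt_mul hd).1 hNk
        rw [mul_comm] at this; exact this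
      · have := (Nat.le_div_iff_mul_le hd).1 hkM
        rw [mul_comm] at this; exact this
  rw [himage, card_image_of_injective _ (mul_right_injective₀ hd.ne'), Nat.card_Ioc]

/-- `|#{N < n ≤ N + M : d ∣ n} − M/d| ≤ 2` for `d ≥ 1`. [folklore] -/
theorem abs_card_Ioc_filter_dvd_sub_le {d : ℕ} (hd : 0 < d) (N M : ℕ) :
    |(#((Ioc N (N + M)).filter (fun n : ℕ => d ∣ n)) : ℝ) - (M : ℝ) / d| ≤ 2 := by
  rw [card_Ioc_filter_dvd_eq hd]
  have hmono : N / d ≤ (N + M) / d := Nat.div_le_div_right (Nat.le_add_right N M)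
  rw [Nat.cast_sub hmono]
  have hd0 : (0 : ℝ) < d := by exact_mod_cast hd
  have h1 : (((N + M) / d : ℕ) : ℝ) ≤ ((N + M : ℕ) : ℝ) / d := Nat.cast_div_le
  have h2 : ((N / d : ℕ) : ℝ) ≤ (N : ℝ) / d := Nat.cast_div_le
  have h3 : ((N + M : ℕ) : ℝ) / d - 1 < (((N + M) / d : ℕ) : ℝ) := by
    have := Nat.lt_div_mul_add (a := N + M) hd
    have h' : ((N + M : ℕ) : ℝ) < (((N + M) / d : ℕ) : ℝ) * d + d := by exact_mod_cast this
    rw [div_sub_one hd0.ne', div_lt_iff₀ hd0]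
    linarith
  have h4 : (N : ℝ) / d - 1 < ((N / d : ℕ) : ℝ) := by
    have := Nat.lt_div_mul_add (a := N) hd
    have h' : ((N : ℕ) : ℝ) < ((N / d : ℕ) : ℝ) * d + d := by exact_mod_cast this
    rw [div_sub_one hd0.ne', div_lt_iff₀ hd0]
    linarith
  have h5 : ((N + M : ℕ) : ℝ) / d = (N : ℝ) / d + (M : ℝ) / d := by push_cast; ring
  rw [abs_le]
  constructor <;> linarith

/-! ### Rough numbers in a short interval -/

/-- **Rough numbers in a short interval (upper-bound sieve).** There is an absolute `K > 0` such
that for all real `z ≥ 2` and all `N, M ∈ ℕ`,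
`#{N < n ≤ N + M : (n, P(z)) = 1} ≤ K (M / log z + z^{10})`, `P(z) = ∏_{p<z} p`.
Proof: the beta-sieve upper bound of level `D = z^{10}` (`SieveSequence.sifted_le_of_dvd_primesProdBelow`,
dimension `1`) for the sequence `a_n = 1_{n > N}` with `X = x − N`, `g(d) = 1/d`, `|R_d| ≤ 2`,
`V(z) ≤ 1/log z`. [cite: HalberstamRichert1974, Ch. 3 (Brun–Titchmarsh theorem)]; the bound itself is
[folklore]. -/
theorem card_rough_Ioc_le :
    ∃ K : ℝ, 0 < K ∧ ∀ z : ℝ, 2 ≤ z → ∀ N M : ℕ,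
      (#((Ioc N (N + M)).filter (fun n : ℕ => n.Coprime (primesProdBelow z))) : ℝ) ≤
        K * (M / Real.log z + z ^ (10 : ℕ)) := by
  obtain ⟨K₀, hK₀⟩ := hasSieveDimension_reciprocalDensity_one_holds
  have hK₀1 : 1 ≤ K₀ := hK₀.one_le
  refine ⟨1 + 2 * K₀ ^ (10 : ℕ), by positivity, fun z hz N M => ?_⟩
  have hz1 : 1 < z := by linarith
  have hz0 : 0 < z := by linarith
  have hlogz : 0 < Real.log z := Real.log_pos hz1
  -- the shifted interval as a sifted sequence: `a_n = 1_{n > N}`, `X(y) = y − N`, `g(d) = 1/d`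
  let A : SieveSequence :=
    { a := fun n => if N < n then 1 else 0
      a_nonneg := fun n => by
        split_ifs
        · exact zero_le_one
        · exact le_rfl
      size := fun y => y - N
      density := reciprocalDensity
      density_mult := isMultiplicative_reciprocalDensity }
  have hAa : ∀ n, A.a n = if N < n then 1 else 0 := fun n => rfl
  have hsize : ∀ y, A.size y = y - N := fun y => rfl
  have hdens : A.density = reciprocalDensity := rfl
  -- the sifting set `P = ∏_{p < z, p ∤ 1} p = P(z)` and the level `D = z^{10}`
  set P := ∏ p ∈ (Nat.primesBelow ⌈z⌉₊).filter (fun p : ℕ => ¬ p ∣ 1), p with hP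
  set D : ℝ := z ^ (10 : ℕ) with hD
  set x : ℝ := ((N + M : ℕ) : ℝ) with hx
  have hxfloor : ⌊x⌋₊ = N + M := by rw [hx, Nat.floor_natCast]
  have hdim : HasSieveDimension A.density 1 K₀ := hK₀
  have hD1 : 1 < D := one_lt_pow₀ hz1 (by norm_num)
  have hzD : (9 * (1 : ℝ) + 1) * Real.log z ≤ Real.log D := by
    rw [hD, Real.log_pow]; norm_num
  have hX : 0 ≤ A.size x := by
    rw [hsize, hx]; push_cast; linarith
  have hsieve := SieveSequence.sifted_le_of_dvd_primesProdBelow hdim one_pos hz hD1 hzD hX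
    (prod_primesBelow_filter_not_dvd_dvd z 1)
  have hexp : Real.exp ((9 * (1 : ℝ) + 1) - Real.log D / Real.log z) = 1 := by
    rw [hD, Real.log_pow, Nat.cast_ofNat, mul_div_assoc, div_self hlogz.ne']
    norm_num
  rw [hexp, mul_one] at hsieve
  -- the set to count is inside the sifted set
  have hcount : (#((Ioc N (N + M)).filter (fun n : ℕ => n.Coprime (primesProdBelow z))) : ℝ) ≤
      A.sifted x P := by
    classical
    rw [A.sifted_eq_card {n : ℕ | N < n} (fun n => by rw [hAa]; rfl) x P, hxfloor]
    have hsub : (Ioc N (N + M)).filter (fun n : ℕ => n.Coprime (primesProdBelow z)) ⊆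
        (Ioc 0 (N + M)).filter (fun n : ℕ => n ∈ {n : ℕ | N < n} ∧ n.Coprime P) := by
      intro n hn
      rw [Finset.mem_filter, Finset.mem_Ioc] at hn
      rw [Finset.mem_filter, Finset.mem_Ioc, Set.mem_setOf_eq]
      exact ⟨⟨by omega, hn.1.2⟩, hn.1.1,
        Nat.Coprime.coprime_dvd_right (prod_primesBelow_filter_not_dvd_dvd z 1) hn.2⟩
    exact_mod_cast Finset.card_le_card hsub
  -- main term: `X V(P) ≤ M / log z`
  have hmain : A.size x * A.densityProduct P ≤ (M : ℝ) / Real.log z := by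
    rw [hsize, hx]
    have hV := SieveSequence.densityProduct_prod_primesBelow_filter_not_dvd_le hdens hz1 one_pos
    rw [Nat.totient_one, Nat.cast_one, div_one] at hV
    have hM : ((N + M : ℕ) : ℝ) - N = M := by push_cast; ring
    rw [hM, div_eq_mul_one_div]
    exact mul_le_mul_of_nonneg_left hV (Nat.cast_nonneg M)
  -- remainders: `|R_d(x)| ≤ 2`
  have hrem1 : ∀ d : ℕ, 0 < d → |A.remainder d x| ≤ 2 := by
    intro d hd
    have hcongr : A.congrSum d x = #((Ioc N (N + M)).filter (fun n : ℕ => d ∣ n)) := by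
      rw [SieveSequence.congrSum, hxfloor]
      simp only [hAa, Finset.sum_boole, Finset.filter_filter]
      congr 2
      ext n
      simp only [Finset.mem_filter, Finset.mem_Ioc]
      omega
    rw [SieveSequence.remainder, hcongr, hdens, reciprocalDensity_apply, hsize, hx]
    have hM : ((N + M : ℕ) : ℝ) - N = M := by push_cast; ring
    rw [hM, inv_mul_eq_div]
    exact abs_card_Ioc_filter_dvd_sub_le hd N M
  have hrem : ∑ d ∈ P.divisors.filter (fun d : ℕ => (d : ℝ) ≤ D), |A.remainder d x| ≤ 2 * D := by
    calc ∑ d ∈ P.divisors.filter (fun d : ℕ => (d : ℝ) ≤ D), |A.remainder d x|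
        ≤ ∑ d ∈ P.divisors.filter (fun d : ℕ => (d : ℝ) ≤ D), (2 : ℝ) := by
          refine Finset.sum_le_sum fun d hd => ?_
          obtain ⟨hd, -⟩ := Finset.mem_filter.1 hd
          exact hrem1 d (Nat.pos_of_mem_divisors hd)
      _ = 2 * #(P.divisors.filter (fun d : ℕ => (d : ℝ) ≤ D)) := by
          rw [Finset.sum_const, nsmul_eq_mul, mul_comm]
      _ ≤ 2 * #(Icc 1 ⌊D⌋₊) := by
          gcongr
          intro d hd
          obtain ⟨hd, hdD⟩ := Finset.mem_filter.1 hd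
          rw [Finset.mem_Icc]
          exact ⟨Nat.pos_of_mem_divisors hd, Nat.le_floor hdD⟩
      _ ≤ 2 * D := by
          rw [Nat.card_Icc, Nat.add_sub_cancel]
          exact mul_le_mul_of_nonneg_left (Nat.floor_le (by positivity)) (by norm_num)
  -- assemble
  have hK : (0 : ℝ) ≤ 1 + 2 * K₀ ^ (10 : ℕ) := by positivity
  have h2 : (2 : ℝ) ≤ 1 + 2 * K₀ ^ (10 : ℕ) := by
    have : (1 : ℝ) ≤ K₀ ^ (10 : ℕ) := one_le_pow₀ hK₀1
    linarith
  calc (#((Ioc N (N + M)).filter (fun n : ℕ => n.Coprime (primesProdBelow z))) : ℝ)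
      ≤ A.sifted x P := hcount
    _ ≤ (1 + 2 * K₀ ^ (10 : ℕ)) * (A.size x * A.densityProduct P) +
          ∑ d ∈ P.divisors.filter (fun d : ℕ => (d : ℝ) ≤ D), |A.remainder d x| := hsieve
    _ ≤ (1 + 2 * K₀ ^ (10 : ℕ)) * ((M : ℝ) / Real.log z) + 2 * D :=
        add_le_add (mul_le_mul_of_nonneg_left hmain hK) hrem
    _ ≤ (1 + 2 * K₀ ^ (10 : ℕ)) * ((M : ℝ) / Real.log z) + (1 + 2 * K₀ ^ (10 : ℕ)) * D := by
        have hD0 : (0 : ℝ) ≤ D := by positivity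
        nlinarith [mul_le_mul_of_nonneg_right h2 hD0]
    _ = (1 + 2 * K₀ ^ (10 : ℕ)) * ((M : ℝ) / Real.log z + z ^ (10 : ℕ)) := by
        rw [hD]; ring

/-! ### Primes in a short interval -/

/-- `log M ≤ 2 √M` for `M ≥ 0` (private copy; cf. `Literature.NumberTheory.Sieve.SelbergSymmetry.log_le_two_mul_sqrt`,
stated there for `M > 0`, whose heavy file is not imported here). [folklore] -/
private theorem log_le_two_mul_sqrt' {M : ℝ} (hM : 0 ≤ M) : Real.log M ≤ 2 * Real.sqrt M := by
  have h := Real.log_le_rpow_div hM (by norm_num : (0 : ℝ) < 1 / 2)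
  rw [Real.sqrt_eq_rpow]
  linarith [show M ^ (1 / 2 : ℝ) / (1 / 2) = 2 * M ^ (1 / 2 : ℝ) by ring]

/-- **Brun–Titchmarsh for short intervals** (weak form): there is an absolute `C > 0` with
`π(N + M) − π(N) = #{N < p ≤ N + M} ≤ C M / log M` for all `N ∈ ℕ` and `M ≥ 2`.
(Montgomery–Vaughan prove the constant `2`; any absolute constant is what the mean value theorem
for prime Dirichlet polynomials consumes.)  Proof: primes `p ≤ N + M` with `p > N` are either `< z`
(at most `z + 1` of them) or prime to `P(z)`; take `z = M^{1/20}` in `card_rough_Ioc_le`.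
[cite: HalberstamRichert1974, Ch. 3 (Brun–Titchmarsh theorem)]; [folklore]. -/
theorem card_primes_Ioc_le :
    ∃ C : ℝ, 0 < C ∧ ∀ N M : ℕ, 2 ≤ M →
      (#((Ioc N (N + M)).filter Nat.Prime) : ℝ) ≤ C * M / Real.log M := by
  obtain ⟨K, hK, hrough⟩ := card_rough_Ioc_le
  refine ⟨20 * K + 2 * K + 4 + 14, by positivity, fun N M hM => ?_⟩
  have hM0 : (0 : ℝ) < M := by exact_mod_cast (zero_lt_two.trans_le hM)
  have hM1 : (1 : ℝ) < M := by exact_mod_cast (one_lt_two.trans_le hM)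
  have hlogM : 0 < Real.log M := Real.log_pos hM1
  have hlog2 : Real.log 2 < 0.6931471808 := Real.log_two_lt_d9
  -- the trivial bound `≤ M`
  have htriv : (#((Ioc N (N + M)).filter Nat.Prime) : ℝ) ≤ M := by
    calc (#((Ioc N (N + M)).filter Nat.Prime) : ℝ) ≤ #(Ioc N (N + M)) := by
          exact_mod_cast Finset.card_filter_le _ _
      _ = M := by rw [Nat.card_Ioc, Nat.add_sub_cancel_left]
  have hdiv0 : 0 ≤ (M : ℝ) / Real.log M := by positivity
  by_cases hsmall : M < 2 ^ 20
  · -- `log M < 20 log 2 < 14`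
    have hlog14 : Real.log M < 14 := by
      have h1 : (M : ℝ) < (2 : ℝ) ^ 20 := by exact_mod_cast hsmall
      have h2 := Real.log_lt_log hM0 h1
      rw [Real.log_pow] at h2
      push_cast at h2
      linarith
    have h3 : (M : ℝ) ≤ 14 * (M / Real.log M) := by
      rw [mul_div_assoc', le_div_iff₀ hlogM]
      nlinarith
    calc (#((Ioc N (N + M)).filter Nat.Prime) : ℝ) ≤ M := htriv
      _ ≤ 14 * (M / Real.log M) := h3
      _ ≤ (20 * K + 2 * K + 4 + 14) * (M / Real.log M) := by
          refine mul_le_mul_of_nonneg_right ?_ hdiv0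
          linarith [hK.le]
      _ = (20 * K + 2 * K + 4 + 14) * M / Real.log M := by ring
  · rw [not_lt] at hsmall
    -- `z = M^{1/20} ≥ 2`
    set z : ℝ := (M : ℝ) ^ ((1 : ℝ) / 20) with hz_def
    have hM20 : (2 : ℝ) ^ (20 : ℕ) ≤ M := by exact_mod_cast hsmall
    have hz2 : 2 ≤ z := by
      have h1 : (2 : ℝ) = ((2 : ℝ) ^ (20 : ℕ)) ^ ((1 : ℝ) / 20) := by
        rw [← Real.rpow_natCast, ← Real.rpow_mul (by norm_num)]; norm_num
      rw [h1, hz_def]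
      exact Real.rpow_le_rpow (by positivity) hM20 (by norm_num)
    have hz0 : 0 < z := by linarith
    have hlogz : Real.log z = (1 / 20) * Real.log M := by
      rw [hz_def, Real.log_rpow hM0]
    have hz10 : z ^ (10 : ℕ) = Real.sqrt M := by
      rw [hz_def, ← Real.rpow_natCast, ← Real.rpow_mul hM0.le, Real.sqrt_eq_rpow]
      norm_num
    have hzsqrt : z ≤ Real.sqrt M := by
      rw [hz_def, Real.sqrt_eq_rpow]
      exact Real.rpow_le_rpow_of_exponent_le hM1.le (by norm_num)
    have hsqrtM : Real.sqrt M ≤ 2 * (M / Real.log M) := by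
      have h1 := log_le_two_mul_sqrt' hM0.le
      have h2 : 0 ≤ Real.sqrt M := Real.sqrt_nonneg _
      rw [mul_div_assoc', le_div_iff₀ hlogM]
      calc Real.sqrt M * Real.log M ≤ Real.sqrt M * (2 * Real.sqrt M) :=
            mul_le_mul_of_nonneg_left h1 h2
        _ = 2 * M := by rw [mul_comm, mul_assoc, Real.mul_self_sqrt hM0.le]
    have hone : 1 ≤ (M : ℝ) / Real.log M := by
      rw [le_div_iff₀ hlogM, one_mul]
      have := Real.log_le_sub_one_of_pos hM0
      linarith
    -- split the primes of `(N, N+M]` at `⌈z⌉`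
    set s := (Ioc N (N + M)).filter Nat.Prime with hs
    have hsplit := Finset.card_filter_add_card_filter_not (s := s) (fun p : ℕ => p < ⌈z⌉₊)
    have hlow : (#(s.filter (fun p : ℕ => p < ⌈z⌉₊)) : ℝ) ≤ z + 1 := by
      calc (#(s.filter (fun p : ℕ => p < ⌈z⌉₊)) : ℝ) ≤ #(range ⌈z⌉₊) := by
            exact_mod_cast Finset.card_le_card fun p hp => by
              rw [Finset.mem_range]; exact (Finset.mem_filter.1 hp).2
        _ = ⌈z⌉₊ := by rw [Finset.card_range]
        _ ≤ z + 1 := (Nat.ceil_lt_add_one hz0.le).le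
    have hhigh : (#(s.filter (fun p : ℕ => ¬ p < ⌈z⌉₊)) : ℝ) ≤
        K * ((M : ℝ) / Real.log z + z ^ (10 : ℕ)) := by
      refine le_trans ?_ (hrough z hz2 N M)
      exact_mod_cast Finset.card_le_card fun p hp => by
        rw [Finset.mem_filter] at hp ⊢
        obtain ⟨hps, hpz⟩ := hp
        rw [hs, Finset.mem_filter] at hps
        refine ⟨hps.1, (Nat.Prime.coprime_iff_not_dvd hps.2).2 fun hdvd => hpz ?_⟩
        exact Nat.lt_ceil.2 ((dvd_primesProdBelow_iff hps.2 z).1 hdvd)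
    have htot : (#s : ℝ) ≤ z + 1 + K * ((M : ℝ) / Real.log z + z ^ (10 : ℕ)) := by
      have := congrArg (fun n : ℕ => (n : ℝ)) hsplit
      push_cast at this
      linarith
    rw [hlogz, hz10] at htot
    have hMlog : (M : ℝ) / (1 / 20 * Real.log M) = 20 * (M / Real.log M) := by
      field_simp
    rw [hMlog] at htot
    calc (#s : ℝ) ≤ z + 1 + K * (20 * (M / Real.log M) + Real.sqrt M) := htot
      _ ≤ 2 * (M / Real.log M) + (M / Real.log M) +
            K * (20 * (M / Real.log M) + 2 * (M / Real.log M)) := by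
          have h1 : z ≤ 2 * (M / Real.log M) := hzsqrt.trans hsqrtM
          have h2 : K * (20 * (M / Real.log M) + Real.sqrt M) ≤
              K * (20 * (M / Real.log M) + 2 * (M / Real.log M)) :=
            mul_le_mul_of_nonneg_left (by linarith) hK.le
          linarith
      _ = (20 * K + 2 * K + 3) * (M / Real.log M) := by ring
      _ ≤ (20 * K + 2 * K + 4 + 14) * (M / Real.log M) :=
          mul_le_mul_of_nonneg_right (by linarith) hdiv0
      _ = (20 * K + 2 * K + 4 + 14) * M / Real.log M := by ring

/-- **Chebyshev–Brun–Titchmarsh bound for `θ` in short intervals**: with the constant `C` of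
`card_primes_Ioc_le`, `∑_{N < p ≤ N+M} log p ≤ C M log(N + M) / log M` (`M ≥ 2`). [folklore] -/
theorem sum_log_primes_Ioc_le :
    ∃ C : ℝ, 0 < C ∧ ∀ N M : ℕ, 2 ≤ M →
      ∑ p ∈ (Ioc N (N + M)).filter Nat.Prime, Real.log p ≤
        C * M * Real.log ((N + M : ℕ) : ℝ) / Real.log M := by
  obtain ⟨C, hC, h⟩ := card_primes_Ioc_le
  refine ⟨C, hC, fun N M hM => ?_⟩
  have hNM : (1 : ℝ) < ((N + M : ℕ) : ℝ) := by
    have : 1 < N + M := by omega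
    exact_mod_cast this
  have hlogNM : 0 ≤ Real.log ((N + M : ℕ) : ℝ) := Real.log_nonneg hNM.le
  calc ∑ p ∈ (Ioc N (N + M)).filter Nat.Prime, Real.log p
      ≤ ∑ p ∈ (Ioc N (N + M)).filter Nat.Prime, Real.log ((N + M : ℕ) : ℝ) := by
        refine Finset.sum_le_sum fun p hp => ?_
        have hp' := Finset.mem_filter.1 hp
        have hp1 := (Finset.mem_Ioc.1 hp'.1)
        exact Real.log_le_log (by exact_mod_cast hp'.2.pos) (by exact_mod_cast hp1.2)
    _ = #((Ioc N (N + M)).filter Nat.Prime) * Real.log ((N + M : ℕ) : ℝ) := by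
        rw [Finset.sum_const, nsmul_eq_mul]
    _ ≤ (C * M / Real.log M) * Real.log ((N + M : ℕ) : ℝ) :=
        mul_le_mul_of_nonneg_right (h N M hM) hlogNM
    _ = C * M * Real.log ((N + M : ℕ) : ℝ) / Real.log M := by ring

end Literature.NumberTheory.Sieve
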